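import Mathlib
import Summits.NavierStokesRegularity.NavierStokesRegularity.Theses.ClockStretchingLaw
import Summits.NavierStokesRegularity.NavierStokesRegularity.Theorems.ClockStretchingLawClockCeilingUniformVorticityFloor
import Summits.NavierStokesRegularity.NavierStokesRegularity.Theorems.ClockStretchingLawClockCeilingLerayFloor
import Summits.NavierStokesRegularity.NavierStokesRegularity.Theorems.ClockStretchingLawClockCeilingStubUniformBounds
import Literature.Analysis.FluidPDE.TypeIAncientMild
import Literature.Analysis.FluidPDE.OseenDuhamelPairCalculus
import HarnessLib

/-!
# Route ClockStretchingLaw, crux `ClockCeiling` (stmt-NavierStokesRegularity-10570) — the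
# universal LERAY FLOOR of a singular Type-I model is attained INSIDE the backward paraboloid

Localised upgrade of the universal all-time Leray floor `stub_lerayFloorSingular`
(`ClockStretchingLawClockCeilingLerayFloor.lean`): the floor `√(−t)‖u(t, ·)‖_∞ > ε₀ := 1/(32 C₀)`,
`C₀ = oseenSliceConst`, of a singular element of the crux's Type-I class `𝒦_C`
(`IsTypeIAncientMild C u` with the scale-invariant energy ledger `A, E ≤ C`) is attained at a
point of the backward paraboloid `{‖x‖ < R(C) √(−t)}` above the singular point, with an aperture
`R(C)` depending on the class only.

**`stub_localisedLerayFloor`.** `∀ C ∃ R > 0`: every `u ∈ 𝒦_C` singular at the space–time origin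
has, at EVERY `t < 0`, a point `x` with `‖x‖ < R √(−t)` and `32 C₀ √(−t)‖u(t,x)‖ > 1`.

## Proof

At `t = −1` (`localisedLerayFloor_at_neg_one`): otherwise there are singular `u_n ∈ 𝒦_C` with
`32 C₀ ‖u_n(−1, x)‖ ≤ 1` on the growing balls `‖x‖ < n + 1`; a subsequence converges pointwise
on the open slab (`exists_tendsto_of_typeI_seq_Ioo`) to an element `W` of the Type-I ancient class
that is singular at the origin (`clockLaw_singular_of_limit`) and — every fixed `x` lying in the
balls eventually, limits preserving `≤` — satisfies `32 C₀ ‖W(−1, x)‖ ≤ 1` for ALL `x`, against the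
universal floor `stub_lerayFloorSingular` at `t = −1`. All `t < 0` by the zoom covariance of the
class (`isTypeIAncientMild_zoom`, `limitSingular_energyLedger_zoom`, `clockLaw_singular_zoom`):
the zoom `u_c = c u(c² ·, c ·)`, `c = √(−t)`, is a singular element of `𝒦_C` with
`u_c(−1, y) = c u(t, c y)`, and the ball `‖y‖ < R` at time `−1` becomes `‖x‖ < R√(−t)` at time `t`.

**Corollary `localisedLerayFloor_energy`** (the scaled local energy does not evaporate in the
paraboloid): `∀ C ∃ a > 0 ∃ R' > 0`, every singular `u ∈ 𝒦_C` has
`a ≤ (R'√(−t))⁻¹ ∫_{B(0, R'√(−t))} ‖u(t,x)‖² dx` at every `t < 0` — around the floor point `x*`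
the class gradient bound `‖∇u(−1, ·)‖ ≤ K(C)` (`uniformBounds_exists_mixed`) keeps
`‖u(−1, y)‖ ≥ ε₀/2` on `B(x*, ρ)`, `ρ = ε₀/(2K+1)` (`localisedLerayFloor_plateau_at_neg_one`);
integrate and zoom (`scaledEnergy_zoom`). Likewise the scale-free local `L³` mass:
`b(C) ≤ ∫_{B(0, R'√(−t))} ‖u(t,x)‖³ dx` (`localisedLerayFloor_L3`, `localL3_zoom`).

## References

* J. Leray, Acta Math. 63 (1934), §19–20. [Leray1934]
* G. Koch, N. Nadirashvili, G. Seregin, V. Šverák, Acta Math. 203 (2009) 83–105, §1 (1.2),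
  Prop. 4.1, Lemma 6.1 (arXiv:0709.3599). [KochNadirashviliSereginSverak2009]
* D. Albritton, T. Barker, J. Math. Fluid Mech. 21 (2019), Lemma 2.2 and Prop. 2.3
  (arXiv:1811.00502). [AlbrittonBarker2019]
-/

noncomputable section

-- the summit and its single sub-problem share the name (CONVENTIONS §1), as in every Theorems file
set_option linter.dupNamespace false

open MeasureTheory Filter Topology Set Metric Function
open scoped NNReal ENNReal

namespace Summit.NavierStokesRegularity.NavierStokesRegularity.Theorems

open Literature.Analysis Literature.Analysis.FluidPDE
open Summit.NavierStokesRegularity.NavierStokesRegularity.Theorems.ClockLaw.Birth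

/-- **Localised universal Leray floor at `t = −1`.** For every `C` there is `R > 0` such that every
element of `𝒦_C` singular at the space–time origin has a point `x` with `‖x‖ < R` and
`32 C₀ ‖u(−1, x)‖ > 1`. Compactness along sequences of singular class elements
(`exists_tendsto_of_typeI_seq_Ioo`, `clockLaw_singular_of_limit`) on growing balls, against the
universal floor `stub_lerayFloorSingular` of the (singular) limit at `t = −1`.
[cite: AlbrittonBarker2019, Lemma 2.2 and Prop. 2.3 (arXiv:1811.00502)] -/
theorem localisedLerayFloor_at_neg_one (C : ℝ) :
    ∃ R > 0, ∀ u : ℝ → EuclideanSpace ℝ (Fin 3) → EuclideanSpace ℝ (Fin 3),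
      IsTypeIAncientMild C u →
      (∀ (x₀ : EuclideanSpace ℝ (Fin 3)) (t₀ r : ℝ), t₀ ≤ 0 → 0 < r →
        (∀ t, t₀ - r ^ 2 < t → t < t₀ → r⁻¹ * ∫ x in Metric.ball x₀ r, ‖u t x‖ ^ 2 ≤ C) ∧
          r⁻¹ * ∫ t in Set.Ioo (t₀ - r ^ 2) t₀, ∫ x in Metric.ball x₀ r, ‖fderiv ℝ (u t) x‖ ^ 2 ≤ C) →
      (∀ r > 0, ∀ M : ℝ, ∃ t ∈ Set.Ioo (-(r ^ 2)) (0 : ℝ),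
        ∃ x ∈ Metric.ball (0 : EuclideanSpace ℝ (Fin 3)) r, M < ‖u t x‖) →
      ∃ x ∈ Metric.ball (0 : EuclideanSpace ℝ (Fin 3)) R,
        1 < 32 * oseenSliceConst (EuclideanSpace ℝ (Fin 3)) * ‖u (-1) x‖ := by
  by_contra h
  push Not at h
  -- singular elements below the floor on the ball of radius `n+1` at time `-1`
  have hseq : ∀ n : ℕ, ∃ u : ℝ → EuclideanSpace ℝ (Fin 3) → EuclideanSpace ℝ (Fin 3),
      IsTypeIAncientMild C u ∧
      (∀ (x₀ : EuclideanSpace ℝ (Fin 3)) (t₀ r : ℝ), t₀ ≤ 0 → 0 < r →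
        (∀ t, t₀ - r ^ 2 < t → t < t₀ → r⁻¹ * ∫ x in Metric.ball x₀ r, ‖u t x‖ ^ 2 ≤ C) ∧
          r⁻¹ * ∫ t in Set.Ioo (t₀ - r ^ 2) t₀, ∫ x in Metric.ball x₀ r, ‖fderiv ℝ (u t) x‖ ^ 2 ≤ C) ∧
      (∀ r > 0, ∀ M : ℝ, ∃ t ∈ Set.Ioo (-(r ^ 2)) (0 : ℝ),
        ∃ x ∈ Metric.ball (0 : EuclideanSpace ℝ (Fin 3)) r, M < ‖u t x‖) ∧
      ∀ x ∈ Metric.ball (0 : EuclideanSpace ℝ (Fin 3)) ((n : ℝ) + 1),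
        32 * oseenSliceConst (EuclideanSpace ℝ (Fin 3)) * ‖u (-1) x‖ ≤ 1 := fun n => by
    obtain ⟨u, hu, hE, hsing, hle⟩ := h ((n : ℝ) + 1) (by positivity)
    exact ⟨u, hu, hE, hsing, hle⟩
  choose u hu hE hsing hle using hseq
  -- compactness on the growing windows `(-(k+1), 0)`
  set A : ℕ → ℝ := fun k => -((k : ℝ) + 1) with hA
  have hAt : Tendsto A atTop atBot :=
    tendsto_neg_atTop_atBot.comp (tendsto_natCast_atTop_atTop.atTop_add tendsto_const_nhds)
  have hcont : ∀ k, ContinuousOn (uncurry (u k)) (Ioo (A k) 0 ×ˢ univ) := fun k =>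
    (hu k).continuousOn_uncurry.mono (prod_mono (fun t ht => ht.2) subset_rfl)
  have hdivw : ∀ k, ∀ t ∈ Ioo (A k) 0, IsWeaklyDivFree (u k t) := fun k t ht =>
    (hu k).isWeaklyDivFree ht.2
  have hmild : ∀ k, ∀ s t : ℝ, A k < s → s < t → t < 0 → ∀ x,
      u k t x = UnboundedOperators.heatExtension (u k s) (t - s) x -
        oseenDuhamel 1 s (u k) (u k) t x :=
    fun k s t _ hst ht x => (hu k).mild_eq_heatExtension hst ht x
  have hI : ∀ k, ∀ t ∈ Ioo (A k) 0, ∀ x, ‖u k t x‖ ≤ C / Real.sqrt (-t) := fun k t ht x =>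
    (hu k).norm_le ht.2 x
  obtain ⟨φ, hφ, W, hW, hpt, -, -, -⟩ :=
    exists_tendsto_of_typeI_seq_Ioo C hAt hcont hdivw hmild hI
  -- the limit is singular
  have hWsing := clockLaw_singular_of_limit (fun j => hu (φ j)) (fun j => hE (φ j))
    (fun j => hsing (φ j)) hpt
  -- and below the floor at `-1` everywhere: every `x` lies in the balls eventually
  have hWle : ∀ x, 32 * oseenSliceConst (EuclideanSpace ℝ (Fin 3)) * ‖W (-1) x‖ ≤ 1 := by
    intro x
    have hconv : Tendsto (fun j => 32 * oseenSliceConst (EuclideanSpace ℝ (Fin 3)) *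
        ‖u (φ j) (-1) x‖) atTop (𝓝 (32 * oseenSliceConst (EuclideanSpace ℝ (Fin 3)) *
          ‖W (-1) x‖)) :=
      ((hpt (-1) (by norm_num) x).norm).const_mul _
    have hR : Tendsto (fun j : ℕ => (φ j : ℝ) + 1) atTop atTop :=
      (tendsto_natCast_atTop_atTop.comp hφ.tendsto_atTop).atTop_add tendsto_const_nhds
    have hev : ∀ᶠ j in atTop,
        32 * oseenSliceConst (EuclideanSpace ℝ (Fin 3)) * ‖u (φ j) (-1) x‖ ≤ 1 := by
      filter_upwards [hR.eventually_gt_atTop ‖x‖] with j hj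
      exact hle (φ j) x (by rwa [Metric.mem_ball, dist_zero_right])
    exact le_of_tendsto hconv hev
  obtain ⟨x, hx⟩ := stub_lerayFloorSingular C W hW hWsing (-1) (by norm_num)
  rw [neg_neg, Real.sqrt_one, one_mul] at hx
  exact (not_lt.2 (hWle x)) hx

/-- **Stub `stub_localisedLerayFloor` (crux stmt-NavierStokesRegularity-10570, line `registered`,
portrait clause) — the universal Leray floor of a singular Type-I model is attained inside the
backward paraboloid.** For every `C` there is `R > 0` such that every `u ∈ 𝒦_C`
(`IsTypeIAncientMild C u` with the energy ledger `A, E ≤ C`) singular at the space–time origin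
has, at every `t < 0`, a point `x` with `‖x‖ < R √(−t)` and `32 C₀ √(−t)‖u(t, x)‖ > 1`,
`C₀ = oseenSliceConst`. The floor at `t = −1` (`localisedLerayFloor_at_neg_one`) transported by
the zoom `u_c = c u(c² ·, c ·)`, `c = √(−t)` (`isTypeIAncientMild_zoom`,
`limitSingular_energyLedger_zoom`, `clockLaw_singular_zoom`, `zoom_apply`), under which
`√(−s)‖u_c(s, y)‖` is invariant. [cite: KochNadirashviliSereginSverak2009, §1 (1.2) and Prop. 4.1 (arXiv:0709.3599)] -/
theorem stub_localisedLerayFloor : ∀ C : ℝ, ∃ R > 0, ∀ u : ℝ → EuclideanSpace ℝ (Fin 3) → EuclideanSpace ℝ (Fin 3), Literature.Analysis.FluidPDE.IsTypeIAncientMild C u → (∀ (x₀ : EuclideanSpace ℝ (Fin 3)) (t₀ r : ℝ), t₀ ≤ 0 → 0 < r → (∀ t, t₀ - r ^ 2 < t → t < t₀ → r⁻¹ * ∫ x in Metric.ball x₀ r, ‖u t x‖ ^ 2 ≤ C) ∧ r⁻¹ * ∫ t in Set.Ioo (t₀ - r ^ 2) t₀, ∫ x in Metric.ball x₀ r, ‖fderiv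 ℝ (u t) x‖ ^ 2 ≤ C) → (∀ r > 0, ∀ M : ℝ, ∃ t ∈ Set.Ioo (-(r ^ 2)) (0 : ℝ), ∃ x ∈ Metric.ball (0 : EuclideanSpace ℝ (Fin 3)) r, M < ‖u t x‖) → ∀ t < 0, ∃ x ∈ Metric.ball (0 : EuclideanSpace ℝ (Fin 3)) (R * Real.sqrt (-t)), 1 < 32 * Literature.Analysis.FluidPDE.oseenSliceConst (EuclideanSpace ℝ (Fin 3)) * (Real.sqrt (-t) * ‖u t x‖) := by
  intro C
  obtain ⟨R, hR, hfloor⟩ := localisedLerayFloor_at_neg_one C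
  refine ⟨R, hR, fun u hu hE hsing t ht => ?_⟩
  set c : ℝ := Real.sqrt (-t) with hcdef
  have hc : 0 < c := Real.sqrt_pos.2 (neg_pos.2 ht)
  have hc2 : c ^ 2 = -t := Real.sq_sqrt (neg_pos.2 ht).le
  have hv : IsTypeIAncientMild C (c • stPull (c ^ 2) c 0 0 u) := isTypeIAncientMild_zoom hu hc 0
  have hvE := limitSingular_energyLedger_zoom hu hE hc
  have hvsing := clockLaw_singular_zoom hsing hc
  obtain ⟨y, hy, h1y⟩ := hfloor _ hv hvE hvsing
  refine ⟨c • y, ?_, ?_⟩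
  · rw [Metric.mem_ball, dist_zero_right] at hy ⊢
    rw [norm_smul, Real.norm_of_nonneg hc.le, mul_comm]
    exact mul_lt_mul_of_pos_right hy hc
  · rw [zoom_apply, zero_add, norm_smul, Real.norm_of_nonneg hc.le,
      show c ^ 2 * (-1 : ℝ) = t by rw [hc2]; ring] at h1y
    exact h1y

/-! ### Corollaries: the scaled local energy and the local `L³` mass do not evaporate -/

/-- **A plateau above half the floor at `t = −1`.** For every `C` there are `ρ > 0` and `R > 0`
such that every singular element of `𝒦_C` has a point `x₁`, `‖x₁‖ < R`, with
`‖u(−1, y)‖ ≥ 1/(64 C₀)` on the whole ball `B(x₁, ρ)`: around the floor point of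
`localisedLerayFloor_at_neg_one` the class gradient bound `‖∇u(−1, ·)‖ ≤ K(C)`
(`uniformBounds_exists_mixed 1 0`) and the mean value inequality lose at most
`K ρ ≤ 1/(64 C₀)` for `ρ = (1/(32 C₀))/(2K + 1)`. [cite: KochNadirashviliSereginSverak2009, Prop. 4.1 (arXiv:0709.3599 p. 8)] -/
theorem localisedLerayFloor_plateau_at_neg_one (C : ℝ) :
    ∃ ρ > 0, ∃ R > 0, ∀ u : ℝ → EuclideanSpace ℝ (Fin 3) → EuclideanSpace ℝ (Fin 3),
      IsTypeIAncientMild C u →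
      (∀ (x₀ : EuclideanSpace ℝ (Fin 3)) (t₀ r : ℝ), t₀ ≤ 0 → 0 < r →
        (∀ t, t₀ - r ^ 2 < t → t < t₀ → r⁻¹ * ∫ x in Metric.ball x₀ r, ‖u t x‖ ^ 2 ≤ C) ∧
          r⁻¹ * ∫ t in Set.Ioo (t₀ - r ^ 2) t₀, ∫ x in Metric.ball x₀ r, ‖fderiv ℝ (u t) x‖ ^ 2 ≤ C) →
      (∀ r > 0, ∀ M : ℝ, ∃ t ∈ Set.Ioo (-(r ^ 2)) (0 : ℝ),
        ∃ x ∈ Metric.ball (0 : EuclideanSpace ℝ (Fin 3)) r, M < ‖u t x‖) →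
      ∃ x₁ ∈ Metric.ball (0 : EuclideanSpace ℝ (Fin 3)) R,
        ∀ y ∈ Metric.ball x₁ ρ, 1 / (64 * oseenSliceConst (EuclideanSpace ℝ (Fin 3))) ≤ ‖u (-1) y‖ := by
  by_cases hC : 0 ≤ C
  swap
  · exact ⟨1, one_pos, 1, one_pos, fun u hu _ _ => absurd hu.nonneg hC⟩
  obtain ⟨R, hR, hfloor⟩ := localisedLerayFloor_at_neg_one C
  obtain ⟨K, hK0, hK⟩ := uniformBounds_exists_mixed 1 0 (-1) (by norm_num)
  have hC₀ : 0 < oseenSliceConst (EuclideanSpace ℝ (Fin 3)) := oseenSliceConst_pos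
  set e : ℝ := 1 / (32 * oseenSliceConst (EuclideanSpace ℝ (Fin 3))) with he
  have he0 : 0 < e := by positivity
  have hKC : 0 ≤ K C := hK0 C hC
  set ρ : ℝ := e / (2 * K C + 1) with hρ
  have hρ0 : 0 < ρ := by positivity
  have hKρ : K C * ρ ≤ e / 2 := by
    rw [hρ, mul_div_assoc', div_le_div_iff₀ (by positivity) (by norm_num)]
    nlinarith
  refine ⟨ρ, hρ0, R, hR, fun u hu hE hsing => ?_⟩
  obtain ⟨x₁, hx₁, h1⟩ := hfloor u hu hE hsing
  refine ⟨x₁, hx₁, fun y hy => ?_⟩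
  -- the floor point: `‖u(-1, x₁)‖ > e`
  have hex₁ : e < ‖u (-1) x₁‖ := by
    rw [he, div_lt_iff₀ (by positivity)]
    linarith
  -- the class gradient bound at `t = -1`
  have hgrad : ∀ z, ‖fderiv ℝ (u (-1)) z‖ ≤ K C := by
    intro z
    have h := hK C u hu (-1) (by norm_num) z
    simp only [iteratedDeriv_zero, norm_iteratedFDeriv_one, neg_neg, Real.one_rpow, mul_one] at h
    exact h
  have hdiff : ∀ z, DifferentiableAt ℝ (u (-1)) z := fun z =>
    ((hu.contDiff_slice (by norm_num)).differentiable (by simp)).differentiableAt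
  -- mean value inequality on `B(x₁, ρ)`
  have hmv : ‖u (-1) y - u (-1) x₁‖ ≤ K C * ‖y - x₁‖ :=
    convex_univ.norm_image_sub_le_of_norm_fderiv_le (fun z _ => hdiff z) (fun z _ => hgrad z)
      (mem_univ _) (mem_univ _)
  rw [Metric.mem_ball, dist_eq_norm] at hy
  have h2 : K C * ‖y - x₁‖ ≤ K C * ρ := mul_le_mul_of_nonneg_left hy.le hKC
  have h4 : ‖u (-1) x₁‖ - ‖u (-1) y‖ ≤ ‖u (-1) y - u (-1) x₁‖ := by
    rw [norm_sub_rev]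
    exact norm_sub_norm_le _ _
  have h64 : 1 / (64 * oseenSliceConst (EuclideanSpace ℝ (Fin 3))) = e / 2 := by
    rw [he]
    field_simp
    norm_num
  rw [h64]
  linarith

/-- **Local `Lᵖ` mass above the plateau at `t = −1`.** For every `C` and `p : ℕ` there are
`b > 0` and `R' > 0` such that every singular element of `𝒦_C` has
`b ≤ ∫_{B(0, R')} ‖u(−1, x)‖ᵖ dx`: integrate the plateau of `localisedLerayFloor_plateau_at_neg_one`
over `B(x₁, ρ) ⊆ B(0, R + ρ)`, `|B_ρ| = 4πρ³/3` (`EuclideanSpace.volume_ball_fin_three`);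
`b = (1/(64 C₀))ᵖ · 4πρ³/3`, `R' = R + ρ`. [folklore] -/
theorem localisedLerayFloor_mass_at_neg_one (C : ℝ) (p : ℕ) :
    ∃ b > 0, ∃ R' > 0, ∀ u : ℝ → EuclideanSpace ℝ (Fin 3) → EuclideanSpace ℝ (Fin 3),
      IsTypeIAncientMild C u →
      (∀ (x₀ : EuclideanSpace ℝ (Fin 3)) (t₀ r : ℝ), t₀ ≤ 0 → 0 < r →
        (∀ t, t₀ - r ^ 2 < t → t < t₀ → r⁻¹ * ∫ x in Metric.ball x₀ r, ‖u t x‖ ^ 2 ≤ C) ∧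
          r⁻¹ * ∫ t in Set.Ioo (t₀ - r ^ 2) t₀, ∫ x in Metric.ball x₀ r, ‖fderiv ℝ (u t) x‖ ^ 2 ≤ C) →
      (∀ r > 0, ∀ M : ℝ, ∃ t ∈ Set.Ioo (-(r ^ 2)) (0 : ℝ),
        ∃ x ∈ Metric.ball (0 : EuclideanSpace ℝ (Fin 3)) r, M < ‖u t x‖) →
      b ≤ ∫ x in Metric.ball (0 : EuclideanSpace ℝ (Fin 3)) R', ‖u (-1) x‖ ^ p := by
  obtain ⟨ρ, hρ, R, hR, hplat⟩ := localisedLerayFloor_plateau_at_neg_one C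
  have hC₀ : 0 < oseenSliceConst (EuclideanSpace ℝ (Fin 3)) := oseenSliceConst_pos
  set e₂ : ℝ := 1 / (64 * oseenSliceConst (EuclideanSpace ℝ (Fin 3))) with he₂
  have he₂0 : 0 < e₂ := by positivity
  refine ⟨e₂ ^ p * (ρ ^ 3 * (Real.pi * 4 / 3)), by positivity, R + ρ, by positivity,
    fun u hu hE hsing => ?_⟩
  obtain ⟨x₁, hx₁, hge⟩ := hplat u hu hE hsing
  have hlow : ∀ y ∈ Metric.ball x₁ ρ, e₂ ^ p ≤ ‖u (-1) y‖ ^ p := fun y hy =>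
    pow_le_pow_left₀ he₂0.le (hge y hy) p
  -- integrability of `‖u(-1, ·)‖ᵖ` on the big ball, and the inclusion of the balls
  have hcont : Continuous fun y => ‖u (-1) y‖ ^ p :=
    ((hu.continuous_slice (by norm_num)).norm).pow p
  have hint : IntegrableOn (fun y => ‖u (-1) y‖ ^ p)
      (Metric.ball (0 : EuclideanSpace ℝ (Fin 3)) (R + ρ)) volume :=
    (hcont.continuousOn.integrableOn_compact (isCompact_closedBall 0 (R + ρ))).mono_set
      ball_subset_closedBall
  have hsub : Metric.ball x₁ ρ ⊆ Metric.ball (0 : EuclideanSpace ℝ (Fin 3)) (R + ρ) := by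
    intro y hy
    rw [Metric.mem_ball, dist_zero_right] at hx₁ ⊢
    rw [Metric.mem_ball, dist_eq_norm] at hy
    calc ‖y‖ = ‖(y - x₁) + x₁‖ := by rw [sub_add_cancel]
      _ ≤ ‖y - x₁‖ + ‖x₁‖ := norm_add_le _ _
      _ < ρ + R := add_lt_add hy hx₁
      _ = R + ρ := add_comm _ _
  have hvol : (volume (Metric.ball x₁ ρ)).toReal = ρ ^ 3 * (Real.pi * 4 / 3) := by
    rw [EuclideanSpace.volume_ball_fin_three, ENNReal.toReal_mul, ENNReal.toReal_pow,
      ENNReal.toReal_ofReal hρ.le, ENNReal.toReal_ofReal (by positivity)]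
  calc e₂ ^ p * (ρ ^ 3 * (Real.pi * 4 / 3))
      = ∫ _y in Metric.ball x₁ ρ, e₂ ^ p := by
        rw [setIntegral_const, smul_eq_mul, measureReal_def, hvol]
        ring
    _ ≤ ∫ y in Metric.ball x₁ ρ, ‖u (-1) y‖ ^ p :=
        setIntegral_mono_on (integrableOn_const measure_ball_lt_top.ne) (hint.mono_set hsub)
          measurableSet_ball hlow
    _ ≤ ∫ y in Metric.ball (0 : EuclideanSpace ℝ (Fin 3)) (R + ρ), ‖u (-1) y‖ ^ p :=
        setIntegral_mono_set hint
          (Eventually.of_forall fun y => pow_nonneg (norm_nonneg (u (-1) y)) p) hsub.eventuallyLE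

/-- **Corollary `localisedLerayFloor_energy` — the scaled local energy of a singular Type-I model
does not evaporate in the backward paraboloid.** For every `C` there are `a > 0` and `R' > 0`
such that every `u ∈ 𝒦_C` singular at the space–time origin satisfies
`a ≤ (R'√(−t))⁻¹ ∫_{B(0, R'√(−t))} ‖u(t, x)‖² dx` at EVERY `t < 0` (the mass bound at `t = −1`,
`localisedLerayFloor_mass_at_neg_one` with `p = 2`, transported by the zoom: the scaled local
energy is zoom invariant, `scaledEnergy_zoom`). [cite: KochNadirashviliSereginSverak2009, §1 (1.2) (arXiv:0709.3599 p. 2)] -/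
theorem localisedLerayFloor_energy (C : ℝ) :
    ∃ a > 0, ∃ R' > 0, ∀ u : ℝ → EuclideanSpace ℝ (Fin 3) → EuclideanSpace ℝ (Fin 3),
      IsTypeIAncientMild C u →
      (∀ (x₀ : EuclideanSpace ℝ (Fin 3)) (t₀ r : ℝ), t₀ ≤ 0 → 0 < r →
        (∀ t, t₀ - r ^ 2 < t → t < t₀ → r⁻¹ * ∫ x in Metric.ball x₀ r, ‖u t x‖ ^ 2 ≤ C) ∧
          r⁻¹ * ∫ t in Set.Ioo (t₀ - r ^ 2) t₀, ∫ x in Metric.ball x₀ r, ‖fderiv ℝ (u t) x‖ ^ 2 ≤ C) →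
      (∀ r > 0, ∀ M : ℝ, ∃ t ∈ Set.Ioo (-(r ^ 2)) (0 : ℝ),
        ∃ x ∈ Metric.ball (0 : EuclideanSpace ℝ (Fin 3)) r, M < ‖u t x‖) →
      ∀ t < 0, a ≤ (R' * Real.sqrt (-t))⁻¹ *
        ∫ x in Metric.ball (0 : EuclideanSpace ℝ (Fin 3)) (R' * Real.sqrt (-t)), ‖u t x‖ ^ 2 := by
  obtain ⟨b, hb, R', hR', hmass⟩ := localisedLerayFloor_mass_at_neg_one C 2
  refine ⟨R'⁻¹ * b, by positivity, R', hR', fun u hu hE hsing t ht => ?_⟩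
  set c : ℝ := Real.sqrt (-t) with hcdef
  have hc : 0 < c := Real.sqrt_pos.2 (neg_pos.2 ht)
  have hc2 : c ^ 2 = -t := Real.sq_sqrt (neg_pos.2 ht).le
  have hv : IsTypeIAncientMild C (c • stPull (c ^ 2) c 0 0 u) := isTypeIAncientMild_zoom hu hc 0
  have hvE := limitSingular_energyLedger_zoom hu hE hc
  have hvsing := clockLaw_singular_zoom hsing hc
  have key : R'⁻¹ * b ≤ R'⁻¹ * ∫ y in Metric.ball (0 : EuclideanSpace ℝ (Fin 3)) R',
      ‖(c • stPull (c ^ 2) c 0 0 u) (-1) y‖ ^ 2 :=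
    mul_le_mul_of_nonneg_left (hmass _ hv hvE hvsing) (inv_nonneg.2 hR'.le)
  rw [scaledEnergy_zoom hc 0 0 u (-1) hR', smul_zero, add_zero,
    show c ^ 2 * (-1 : ℝ) = t by rw [hc2]; ring, mul_comm c R'] at key
  exact key

/-- **Scaling of the local `L³` mass** (scale invariant): `∫_{B(0, r)} ‖u_c(s, y)‖³ dy =
∫_{B(0, c r)} ‖u(c² s, x)‖³ dx` for the zoom `u_c(s, y) = c u(c² s, c y)` (substitution
`x = c y`, `integral_comp_space_affine`). [folklore] -/
theorem localL3_zoom {c : ℝ} (hc : 0 < c)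
    (u : ℝ → EuclideanSpace ℝ (Fin 3) → EuclideanSpace ℝ (Fin 3)) (s r : ℝ) :
    ∫ y in Metric.ball (0 : EuclideanSpace ℝ (Fin 3)) r, ‖(c • stPull (c ^ 2) c 0 0 u) s y‖ ^ 3 =
      ∫ x in Metric.ball (0 : EuclideanSpace ℝ (Fin 3)) (c * r), ‖u (c ^ 2 * s) x‖ ^ 3 := by
  set F : EuclideanSpace ℝ (Fin 3) → ℝ := fun x => ‖u (c ^ 2 * s) x‖ ^ 3 with hF
  have hpre := space_affine_preimage_ball_zoom hc 0 0 r
  have h1 : (fun y => ‖(c • stPull (c ^ 2) c 0 0 u) s y‖ ^ 3) =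
      fun y => c ^ 3 * F (0 + c • y) := by
    funext y
    rw [zoom_apply, norm_smul, Real.norm_of_nonneg hc.le, mul_pow]
  rw [h1, integral_const_mul]
  have h2 : ∫ y in Metric.ball (0 : EuclideanSpace ℝ (Fin 3)) r, F (0 + c • y) =
      ∫ y, (Metric.ball ((0 : EuclideanSpace ℝ (Fin 3)) + c • (0 : EuclideanSpace ℝ (Fin 3)))
        (c * r)).indicator F (0 + c • y) := by
    rw [← integral_indicator measurableSet_ball, ← hpre]
    rfl
  rw [h2, integral_comp_space_affine hc 0, integral_indicator measurableSet_ball,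
    finrank_euclideanSpace_fin, smul_eq_mul, smul_zero, add_zero, ← mul_assoc,
    mul_inv_cancel₀ (pow_pos hc 3).ne', one_mul]

/-- **Corollary `localisedLerayFloor_L3` — the local `L³` mass of a singular Type-I model in the
backward paraboloid is bounded below, scale-free.** For every `C` there are `b > 0` and `R' > 0`
such that every `u ∈ 𝒦_C` singular at the space–time origin satisfies
`b ≤ ∫_{B(0, R'√(−t))} ‖u(t, x)‖³ dx` at EVERY `t < 0` (mass bound at `t = −1`,
`localisedLerayFloor_mass_at_neg_one` with `p = 3`, then the zoom: the local `L³` mass is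
scale invariant, `localL3_zoom`). [cite: KochNadirashviliSereginSverak2009, §1 (1.2) (arXiv:0709.3599 p. 2)] -/
theorem localisedLerayFloor_L3 (C : ℝ) :
    ∃ b > 0, ∃ R' > 0, ∀ u : ℝ → EuclideanSpace ℝ (Fin 3) → EuclideanSpace ℝ (Fin 3),
      IsTypeIAncientMild C u →
      (∀ (x₀ : EuclideanSpace ℝ (Fin 3)) (t₀ r : ℝ), t₀ ≤ 0 → 0 < r →
        (∀ t, t₀ - r ^ 2 < t → t < t₀ → r⁻¹ * ∫ x in Metric.ball x₀ r, ‖u t x‖ ^ 2 ≤ C) ∧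
          r⁻¹ * ∫ t in Set.Ioo (t₀ - r ^ 2) t₀, ∫ x in Metric.ball x₀ r, ‖fderiv ℝ (u t) x‖ ^ 2 ≤ C) →
      (∀ r > 0, ∀ M : ℝ, ∃ t ∈ Set.Ioo (-(r ^ 2)) (0 : ℝ),
        ∃ x ∈ Metric.ball (0 : EuclideanSpace ℝ (Fin 3)) r, M < ‖u t x‖) →
      ∀ t < 0, b ≤ ∫ x in Metric.ball (0 : EuclideanSpace ℝ (Fin 3)) (R' * Real.sqrt (-t)),
        ‖u t x‖ ^ 3 := by
  obtain ⟨b, hb, R', hR', hmass⟩ := localisedLerayFloor_mass_at_neg_one C 3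
  refine ⟨b, hb, R', hR', fun u hu hE hsing t ht => ?_⟩
  set c : ℝ := Real.sqrt (-t) with hcdef
  have hc : 0 < c := Real.sqrt_pos.2 (neg_pos.2 ht)
  have hc2 : c ^ 2 = -t := Real.sq_sqrt (neg_pos.2 ht).le
  have hv : IsTypeIAncientMild C (c • stPull (c ^ 2) c 0 0 u) := isTypeIAncientMild_zoom hu hc 0
  have hvE := limitSingular_energyLedger_zoom hu hE hc
  have hvsing := clockLaw_singular_zoom hsing hc
  have key := hmass _ hv hvE hvsing
  rw [localL3_zoom hc u (-1) R', show c ^ 2 * (-1 : ℝ) = t by rw [hc2]; ring,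
    mul_comm c R'] at key
  exact key

end Summit.NavierStokesRegularity.NavierStokesRegularity.Theorems

end
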